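import Summits.CriticalPhenomena.PercolationContinuityZ3.Theorems.PercTorusSliceFillingThinClusterTransportLocal
import HarnessLib

/-!
# Crux `PercTorusSliceFilling.TorusNonProliferation` (stmt-CriticalPhenomena-5415), line `registered` (`birth`) — stub `stub_packing`

Helper file for the crux skeleton `Cruxes/TorusNonProliferation/Lines/birth.lean`. Proves exactly
the registered stub signature `stub_packing`; lands with `--supports stmt-CriticalPhenomena-5415`.

## The statement (deterministic packing of slice-filling clusters)

On the discrete torus `T_n = (ℤ/nℤ)³`, `n ≥ 1`, call an open cluster `S` slice-filling (sf) if
`∃ i, ∀ t : ZMod n, ∃ y ∈ S, y i = t`. If every sf cluster of a configuration `ω` has at least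
`s` vertices, then `N_sf(ω) · s ≤ V_sf(ω)`, where `N_sf` is the number of sf clusters and
`V_sf = #{x : C(x) sf}` is their total volume.

## The argument (mass transport)

By the landed cluster-counting identity `ncard_clusters_eq_sum`,
`N_sf = Σ_x 1{C(x) sf} / |C(x)|`, while `V_sf = Σ_x 1{C(x) sf}`. Termwise, for an sf base point `x`
we have `|C(x)| ≥ s` and `|C(x)| ≥ 1` (`x ∈ C(x)`), so `|C(x)|⁻¹ · s ≤ 1`; the other terms vanish.
The generic finite-graph form is `ncard_clusters_mul_le`; the sign hypothesis `0 ≤ s` of the stub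
is not needed for the inequality.
-/

noncomputable section

namespace Summit.CriticalPhenomena.PercolationContinuityZ3.Theorems

open MeasureTheory Set
open Literature.Probability.Percolation Literature.Probability.LatticeModels
open PercTorusSliceFillingThinClusterTransport (ncard_clusters_eq_sum)

namespace PercTorusSliceFillingTorusNonProliferation

/-- **Packing of clusters on a finite graph.** If every open cluster `C(x)` with property `P` has
at least `s` vertices, then `#{clusters S with P S} · s ≤ #{x : P (C x)}`: by mass transport
`#{clusters with P} = Σ_x 1{P (C x)}/|C x|` and each such term times `s` is at most `1{P (C x)}`. -/
theorem ncard_clusters_mul_le {V : Type*} [Fintype V] (ω : BondConfig V) (P : Set V → Prop)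
    (s : ℝ) (hbig : ∀ x : V, P (openCluster ω x) → s ≤ ((openCluster ω x).ncard : ℝ)) :
    (Set.ncard {S : Set V | (∃ x, S = openCluster ω x) ∧ P S} : ℝ) * s ≤
      (Set.ncard {x : V | P (openCluster ω x)} : ℝ) := by
  classical
  rw [ncard_clusters_eq_sum ω P]
  have hV : {x : V | P (openCluster ω x)} =
      ↑(Finset.univ.filter fun x => P (openCluster ω x)) := by
    ext x
    simp
  rw [hV, Set.ncard_coe_finset, Finset.natCast_card_filter, Finset.sum_mul]
  refine Finset.sum_le_sum fun x _ => ?_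
  split_ifs with hx
  · have hpos : (0 : ℝ) < ((openCluster ω x).ncard : ℝ) := by
      exact_mod_cast (Set.ncard_pos (Set.toFinite _)).2 ⟨x, mem_openCluster_self ω x⟩
    rw [inv_mul_le_iff₀ hpos, mul_one]
    exact hbig x hx
  · rw [zero_mul]

/-- **Stub `stub_packing` of the line `birth` (crux `TorusNonProliferation`,
stmt-CriticalPhenomena-5415), exactly the registered signature.** Deterministic packing on the
3-torus `T_n`, `n ≥ 1`: if every slice-filling open cluster of `ω` has at least `s ≥ 0` vertices,
then `N_sf(ω) · s ≤ V_sf(ω) = #{x : C(x) slice-filling}`. Specialisation of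
`ncard_clusters_mul_le` to `P S := ∃ i, ∀ t : ZMod n, ∃ y ∈ S, y i = t`. -/
theorem stub_packing :
    ∀ (n : ℕ), 1 ≤ n → ∀ (ω : BondConfig (TorusSite 3 n)) (s : ℝ), 0 ≤ s →
      (∀ x : TorusSite 3 n, (∃ i : Fin 3, ∀ t : ZMod n, ∃ y ∈ openCluster ω x, y i = t) →
        s ≤ ((openCluster ω x).ncard : ℝ)) →
      (Set.ncard {S : Set (TorusSite 3 n) | (∃ x, S = openCluster ω x) ∧
          ∃ i : Fin 3, ∀ t : ZMod n, ∃ y ∈ S, y i = t} : ℝ) * s ≤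
        (Set.ncard {x : TorusSite 3 n |
          ∃ i : Fin 3, ∀ t : ZMod n, ∃ y ∈ openCluster ω x, y i = t} : ℝ) := by
  intro n hn ω s _hs hbig
  haveI : NeZero n := ⟨by omega⟩
  exact ncard_clusters_mul_le ω (fun S => ∃ i : Fin 3, ∀ t : ZMod n, ∃ y ∈ S, y i = t) s hbig

end PercTorusSliceFillingTorusNonProliferation

end Summit.CriticalPhenomena.PercolationContinuityZ3.Theorems

end
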